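import Literature.Combinatorics.Optimization.GusfieldBreakpointUpperBoundProofs
import HarnessLib

/-!
# Gusfield's breakpoint bound on a LAYERED parametric DAG: the base of the recursion is the WIDTH
# (Gajjar–Radhakrishnan 2019, §1.2: the recursion `f(n, 2^k − 1) ≤ 2n·f(n, 2^{k−1} − 1)` for layered graphs)

Topic `Literature/Combinatorics/Optimization`; companion of `GusfieldBreakpointUpperBoundProofs.lean` (Dean's doubling
recursion on the tree's model `ParamDAG k`, proved there with the TOTAL number of vertices `n = k + 1` as the base:
`ParamDAG.gusfieldDean_breakpoints_lt_holds`, `#bp < (2(k+1))^{⌈log₂ k⌉}`).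

What is printed.  Gajjar–Radhakrishnan [GajjarRadhakrishnan2019], arXiv:1811.05115v2 §1.2 p. 5 (Def. 8 and L20–21):
for the LAYERED graph `G[n,m]` (`m` layers of `n` vertices, arcs between consecutive layers, affine arc weights) and
`f(n,m)` the longest alternation-free sequence of `s`–`t` paths, "one observes that `f(n,1) = n` and
`f(n, 2^k − 1) ≤ 2n·f(n, 2^{k−1} − 1)`, which yields `f(n, 2^k − 1) ≤ ½(2n)^k`" — the base of the recursion is the
number `n` of vertices PER LAYER (the candidates for the middle vertex of a path), not the total number of vertices.

What is typed (the AS-PROVED form, for the number of linear PIECES / breakpoints, exactly as the companion file reads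
Nikolova's Lemma 6.1.7): a `ParamDAG k` together with a LAYERING `lv` (a level function: every arc goes from a level to
the next one — a plain hypothesis, no new notion) all of whose layers have at most `w` vertices satisfies Dean's
recursion with base `w`,
`P(2M) ≤ w·(2P(M) − 1)` (`Pmax_add_self_le_of_isLayering`), hence `P(2^j) ≤ (2w)^j` (`Pmax_two_pow_le_of_isLayering`)
and **fewer than `(2w)^{⌈log₂ k⌉}` breakpoints** (`breakpoints_lt_of_isLayering`).  The point of the layered form: in a
layered graph every `u`–`v` path has exactly `lv v − lv u` arcs, so in Dean's splitting identity
`D_{M₁+M₂}(u,v) = min_z D_{M₁}(u,z) + D_{M₂}(z,v)` only the `≤ w` vertices `z` of ONE layer contribute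
(`lv_eq_of_mem_lsum_W`); the envelope bookkeeping (`Envelope.card_pieceSlopes_biUnion_le`,
`Envelope.card_pieceSlopes_lsum_add_one_le`) is reused verbatim from `LowerEnvelopeBreakpoints.lean`.
For bounded width the bound is POLYNOMIAL in the number of layers: `(2w)^{⌈log₂ k⌉} ≤ 2w · k^{log₂ (2w)}`.

Honest framing: a textbook upper bound (theorems only, no named fact, no new definition); nothing here bears on any
complexity separation.  Motivation on the consumer side (not used here): the tree's walk designs of the
parametric-assignment census (route KPlusLogSqLaw) are layered graphs of a fixed width.

What is NOT here: GR19's alternation-free sequences `f(n,m)` themselves (a larger quantity than the number of pieces; the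
companion file records why they are not typed), planar graphs (GR19 Thm 1), polynomial weights (GR19 v2 Thm 45).

## References

* [GajjarRadhakrishnan2019] K. Gajjar, J. Radhakrishnan, *Parametric shortest paths in planar graphs*, FOCS 2019;
  arXiv:1811.05115v2 §1.2 p. 5 (Def. 8 `f(n,m)` for the layered graph `G[n,m]`; the recursion L20–21).
* [Nikolova2009] E. Nikolova, *Strategic Algorithms*, PhD thesis, MIT 2009, Lemma 6.1.7 (proof p. 86, B. Dean).
-/

noncomputable section

namespace Literature.Combinatorics.Optimization

namespace ParamDAG

open Envelope

variable {k : ℕ} {G : ParamDAG k}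

/- LAYERING HYPOTHESIS used throughout (no new notion is introduced): `lv : Fin (k+1) → ℕ` is a level function with
`hL : ∀ i j, G.adj i j → lv j = lv i + 1` — every arc goes from a level to the next one (Gajjar–Radhakrishnan's layered
graphs `G[n,m]`: arcs only between consecutive layers); the WIDTH bound is
`hw : ∀ L, #{v | lv v = L} ≤ w`. -/

variable {lv : Fin (k + 1) → ℕ}

/-- In a layered DAG a path with `m` arcs climbs exactly `m` levels.
[cite: GajjarRadhakrishnan2019, arXiv v2 §1.2 p. 5 (Def. 8, the layered graph G[n,m])] -/
theorem Reach.lv_eq (hL : ∀ i j, G.adj i j → lv j = lv i + 1) {u w : Fin (k + 1)} {m : ℕ} {ℓ : ℝ × ℝ}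
    (h : G.Reach u w m ℓ) : lv w = lv u + m := by
  induction h with
  | nil => simp
  | snoc h hadj ih => rw [hL _ _ hadj, ih, Nat.add_assoc]

/-- In a layered DAG the line set `W u w N` does not depend on the arc budget `N` once `N ≥ lv w − lv u`: it is the set
of cost lines of the `u`–`w` paths, all of which have exactly `lv w − lv u` arcs.
[cite: GajjarRadhakrishnan2019, arXiv v2 §1.2 p. 5 (Def. 8, the layered graph G[n,m])] -/
theorem mem_W_iff_of_isLayering (hL : ∀ i j, G.adj i j → lv j = lv i + 1) {u w : Fin (k + 1)} {N : ℕ} (huw : lv u ≤ lv w)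
    (hN : lv w - lv u ≤ N) {ℓ : ℝ × ℝ} : ℓ ∈ G.W u w N ↔ G.Reach u w (lv w - lv u) ℓ := by
  rw [mem_W]
  constructor
  · rintro ⟨m, -, h⟩
    have hm : m = lv w - lv u := by have := h.lv_eq hL; omega
    exact hm ▸ h
  · intro h
    exact ⟨lv w - lv u, hN, h⟩

/-- Two sufficient arc budgets give the same line set in a layered DAG.
[cite: GajjarRadhakrishnan2019, arXiv v2 §1.2 p. 5 (Def. 8, the layered graph G[n,m])] -/
theorem W_eq_W_of_isLayering (hL : ∀ i j, G.adj i j → lv j = lv i + 1) {u w : Fin (k + 1)} {N N' : ℕ} (huw : lv u ≤ lv w)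
    (hN : lv w - lv u ≤ N) (hN' : lv w - lv u ≤ N') : G.W u w N = G.W u w N' := by
  ext ℓ
  rw [mem_W_iff_of_isLayering hL huw hN, mem_W_iff_of_isLayering hL huw hN']

/-- In a layered DAG a line set `W u w N` with `lv w < lv u` or `N < lv w − lv u` is empty.
[cite: GajjarRadhakrishnan2019, arXiv v2 §1.2 p. 5 (Def. 8, the layered graph G[n,m])] -/
theorem W_eq_empty_of_isLayering (hL : ∀ i j, G.adj i j → lv j = lv i + 1) {u w : Fin (k + 1)} {N : ℕ}
    (h : lv w < lv u ∨ lv u + N < lv w) : G.W u w N = ∅ := by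
  rw [Finset.eq_empty_iff_forall_notMem]
  intro ℓ hℓ
  obtain ⟨m, hm, hr⟩ := mem_W.1 hℓ
  have := hr.lv_eq hL
  omega

/-- **Only one layer of middle vertices contributes.**  If the sum set `W u z M₁ + W z w M₂` is non-empty and
`lv w = lv u + M₁ + M₂`, then the middle vertex `z` lies on the level `lv u + M₁`.
[cite: GajjarRadhakrishnan2019, arXiv v2 §1.2 p. 5 (the recursion: 2n choices … n vertices per layer)] -/
theorem lv_eq_of_mem_lsum_W (hL : ∀ i j, G.adj i j → lv j = lv i + 1) {u z w : Fin (k + 1)} {M₁ M₂ : ℕ}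
    (hw : lv w = lv u + M₁ + M₂) {ℓ : ℝ × ℝ} (hℓ : ℓ ∈ lsum (G.W u z M₁) (G.W z w M₂)) :
    lv z = lv u + M₁ := by
  obtain ⟨ℓ₁, hℓ₁, ℓ₂, hℓ₂, -⟩ := mem_lsum.1 hℓ
  obtain ⟨m₁, hm₁, h₁⟩ := mem_W.1 hℓ₁
  obtain ⟨m₂, hm₂, h₂⟩ := mem_W.1 hℓ₂
  have e₁ := h₁.lv_eq hL
  have e₂ := h₂.lv_eq hL
  omega

/-- A layer bound `w` is at least `1` (the layer of the source is inhabited). Plumbing. [folklore] -/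
private theorem one_le_of_layerBound {w : ℕ}
    (hw : ∀ L : ℕ, (Finset.univ.filter fun v : Fin (k + 1) => lv v = L).card ≤ w) : 1 ≤ w := by
  refine le_trans ?_ (hw (lv 0))
  exact Finset.card_pos.2 ⟨0, Finset.mem_filter.2 ⟨Finset.mem_univ _, rfl⟩⟩

/-- **`#pieces(D_{2M}(u,w)) ≤ w·(2P(M) − 1)` on a layered DAG of width `≤ w`** (Dean's step with the middle vertex
ranging over ONE layer).
[cite: GajjarRadhakrishnan2019, arXiv v2 §1.2 p. 5 (recursion f(n,2^k−1) ≤ 2n f(n,2^{k−1}−1))] -/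
theorem card_pieceSlopes_W_add_self_le_of_isLayering (hL : ∀ i j, G.adj i j → lv j = lv i + 1) {w : ℕ}
    (hw : ∀ L : ℕ, (Finset.univ.filter fun v : Fin (k + 1) => lv v = L).card ≤ w) (u x : Fin (k + 1)) (M : ℕ) :
    (pieceSlopes (G.W u x (M + M))).card ≤ w * (2 * G.Pmax M - 1) := by
  classical
  have hw1 : 1 ≤ w := one_le_of_layerBound hw
  have hP : 1 ≤ G.Pmax M := one_le_Pmax M
  have hRHS : 1 ≤ w * (2 * G.Pmax M - 1) := by
    calc 1 = 1 * 1 := rfl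
      _ ≤ w * (2 * G.Pmax M - 1) := Nat.mul_le_mul hw1 (by omega)
  -- degenerate pairs: no `u`–`x` path with `≤ M + M` arcs
  by_cases hux : lv u ≤ lv x ∧ lv x ≤ lv u + (M + M)
  swap
  · rw [W_eq_empty_of_isLayering hL (by omega), card_pieceSlopes_empty]
    exact hRHS
  obtain ⟨hux, hm⟩ := hux
  -- the split `m = M₁ + M₂` adapted to the pair, `M₁, M₂ ≤ M`
  set m : ℕ := lv x - lv u with hmdef
  set M₁ : ℕ := min m M with hM₁
  set M₂ : ℕ := m - M₁ with hM₂
  have hM₁M : M₁ ≤ M := Nat.min_le_right _ _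
  have hM₁m : M₁ ≤ m := Nat.min_le_left _ _
  have hM₂M : M₂ ≤ M := by
    rcases le_total m M with h | h
    · have : M₁ = m := Nat.min_eq_left h
      omega
    · have : M₁ = M := Nat.min_eq_right h
      omega
  have hsum : M₁ + M₂ = m := by omega
  have hx : lv x = lv u + M₁ + M₂ := by omega
  -- `W u x (M+M) = W u x (M₁+M₂) = ⋃_z (W u z M₁ + W z x M₂)`
  have hWW : G.W u x (M + M) = G.W u x (M₁ + M₂) :=
    W_eq_W_of_isLayering hL hux (by omega) (by omega)
  rw [hWW, W_add]
  set F : Fin (k + 1) → Finset (ℝ × ℝ) := fun z => lsum (G.W u z M₁) (G.W z x M₂) with hF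
  set S : Finset (Fin (k + 1)) := Finset.univ.filter fun z => (F z).Nonempty with hS
  -- dropping the empty members of the union
  have hunion : (Finset.univ.biUnion F) = S.biUnion F := by
    ext ℓ
    simp only [Finset.mem_biUnion, Finset.mem_univ, true_and, hS, Finset.mem_filter]
    constructor
    · rintro ⟨z, hz⟩
      exact ⟨z, ⟨ℓ, hz⟩, hz⟩
    · rintro ⟨z, -, hz⟩
      exact ⟨z, hz⟩
  rw [hunion]
  -- the contributing middle vertices lie on one layer, so there are at most `w` of them
  have hSsub : S ⊆ Finset.univ.filter fun z : Fin (k + 1) => lv z = lv u + M₁ := by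
    intro z hz
    obtain ⟨ℓ, hℓ⟩ := (Finset.mem_filter.1 hz).2
    exact Finset.mem_filter.2 ⟨Finset.mem_univ _, lv_eq_of_mem_lsum_W hL hx hℓ⟩
  have hScard : S.card ≤ w := (Finset.card_le_card hSsub).trans (hw _)
  by_cases hSne : S.Nonempty
  swap
  · rw [Finset.not_nonempty_iff_eq_empty] at hSne
    rw [hSne, Finset.biUnion_empty, card_pieceSlopes_empty]
    exact hRHS
  refine (card_pieceSlopes_biUnion_le S F hSne).trans ?_
  -- each member: a sum of two envelopes with `≤ P(M)` pieces each
  have hmem : ∀ z ∈ S, (pieceSlopes (F z)).card ≤ 2 * G.Pmax M - 1 := by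
    intro z hz
    have hz' : lv z = lv u + M₁ := (Finset.mem_filter.1 (hSsub hz)).2
    have e₁ : G.W u z M₁ = G.W u z M := W_eq_W_of_isLayering hL (by omega) (by omega) (by omega)
    have e₂ : G.W z x M₂ = G.W z x M := W_eq_W_of_isLayering hL (by omega) (by omega) (by omega)
    have h1 := card_pieceSlopes_lsum_add_one_le (G.W u z M₁) (G.W z x M₂)
    have h2 := card_pieceSlopes_W_le_Pmax (G := G) u z M
    have h3 := card_pieceSlopes_W_le_Pmax (G := G) z x M
    rw [e₁, e₂] at h1
    have h4 : (pieceSlopes (F z)).card = (pieceSlopes (lsum (G.W u z M) (G.W z x M))).card := by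
      show (pieceSlopes (lsum (G.W u z M₁) (G.W z x M₂))).card = _
      rw [e₁, e₂]
    omega
  calc ∑ z ∈ S, (pieceSlopes (F z)).card ≤ ∑ _z ∈ S, (2 * G.Pmax M - 1) := Finset.sum_le_sum hmem
    _ = S.card * (2 * G.Pmax M - 1) := by rw [Finset.sum_const, smul_eq_mul]
    _ ≤ w * (2 * G.Pmax M - 1) := Nat.mul_le_mul_right _ hScard

/-- **Dean's recursion with base the WIDTH: `P(2M) ≤ w·(2P(M) − 1)`** on a layered DAG all of whose layers have at
most `w` vertices.  [cite: GajjarRadhakrishnan2019, arXiv v2 §1.2 p. 5 (recursion f(n,2^k−1) ≤ 2n f(n,2^{k−1}−1))] -/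
theorem Pmax_add_self_le_of_isLayering (hL : ∀ i j, G.adj i j → lv j = lv i + 1) {w : ℕ}
    (hw : ∀ L : ℕ, (Finset.univ.filter fun v : Fin (k + 1) => lv v = L).card ≤ w) (M : ℕ) :
    G.Pmax (M + M) ≤ w * (2 * G.Pmax M - 1) :=
  Finset.sup_le fun p _ => card_pieceSlopes_W_add_self_le_of_isLayering hL hw p.1 p.2 M

/-- **`P(2^j) ≤ (2w)^j`** on a layered DAG of width `≤ w` (GR19's `f(n, 2^k − 1) ≤ ½ (2n)^k`, pieces form).
[cite: GajjarRadhakrishnan2019, arXiv v2 §1.2 p. 5 (recursion f(n,2^k−1) ≤ 2n f(n,2^{k−1}−1))] -/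
theorem Pmax_two_pow_le_of_isLayering (hL : ∀ i j, G.adj i j → lv j = lv i + 1) {w : ℕ}
    (hw : ∀ L : ℕ, (Finset.univ.filter fun v : Fin (k + 1) => lv v = L).card ≤ w) (j : ℕ) :
    G.Pmax (2 ^ j) ≤ (2 * w) ^ j := by
  induction j with
  | zero => simpa using (Pmax_one_le (G := G))
  | succ j ih =>
    rw [pow_succ, mul_two]
    refine (Pmax_add_self_le_of_isLayering hL hw _).trans ?_
    have h1 : 2 * G.Pmax (2 ^ j) - 1 ≤ 2 * (2 * w) ^ j := (Nat.sub_le _ _).trans (by omega)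
    calc w * (2 * G.Pmax (2 ^ j) - 1) ≤ w * (2 * (2 * w) ^ j) := Nat.mul_le_mul_left _ h1
      _ = (2 * w) ^ j * (2 * w) := by ring
      _ = (2 * w) ^ (j + 1) := by rw [pow_succ]

/-- **Gusfield's bound on a layered parametric DAG of width `≤ w`: fewer than `(2w)^{⌈log₂ k⌉}` breakpoints**
(`k + 1` vertices in all, so every `s`–`t` path has `≤ k ≤ 2^{⌈log₂ k⌉}` arcs).  For bounded width this is polynomial
in the number of layers, whereas the general form `gusfieldDean_breakpoints_lt` has base `2(k+1)`.
[cite: GajjarRadhakrishnan2019, arXiv v2 §1.2 p. 5 (Def. 8 and the recursion for the layered graph G[n,m])] -/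
theorem breakpoints_lt_of_isLayering (hL : ∀ i j, G.adj i j → lv j = lv i + 1) {w : ℕ}
    (hw : ∀ L : ℕ, (Finset.univ.filter fun v : Fin (k + 1) => lv v = L).card ≤ w) :
    Set.ncard {μ : ℝ | G.IsBreakpoint μ} < (2 * w) ^ Nat.clog 2 k := by
  rw [setOf_isBreakpoint_eq_bp]
  set L := G.W 0 (Fin.last k) (2 ^ Nat.clog 2 k) with hLdef
  by_cases hne : L.Nonempty
  · have h1 := ncard_bp_add_one_le_card_pieceSlopes hne
    have h2 := card_pieceSlopes_W_le_Pmax (G := G) 0 (Fin.last k) (2 ^ Nat.clog 2 k)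
    have h3 := Pmax_two_pow_le_of_isLayering hL hw (Nat.clog 2 k)
    rw [← hLdef] at h2
    omega
  · rw [Finset.not_nonempty_iff_eq_empty] at hne
    have hbp : bp L = ∅ := by
      rw [hne]
      ext μ
      simp only [bp, IsMinAt, Finset.notMem_empty, false_and, exists_false, Set.mem_setOf_eq,
        Set.mem_empty_iff_false]
    rw [hbp, Set.ncard_empty]
    have hw1 : 1 ≤ w := one_le_of_layerBound hw
    positivity

end ParamDAG

end Literature.Combinatorics.Optimization

end
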